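/-
Copyright (c) 2026. All rights reserved.
Released under Apache 2.0 license as described in the file LICENSE.
Authors: abc-iut cell, statement-typer seat abc-iut-L4-t3 (wave 1).
-/
import Literature.AnabelianGeometry.AbsoluteAnabelian.DiagramOverMorphisms

/-!
# 1-morphisms lying over a functor of the bases are compatible with the universal families ([AbsTopIII] Def. 3.5 (v); toolkit, part 2)

S. Mochizuki, *Topics in Absolute Anabelian Geometry III*, Def. 3.5 (ii), (v) pp. 75–76 (manuscript
`paper:url-5493eb38cbb7`, bib key `MochizukiAbsTopIII2015`).  Continuation of `DiagramOverMorphisms.lean` (this seat: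
`OneMorphism.pathIso`, `OneMorphism.OverHom`, `OverHom.pathPrism`) over abc-iut-L4-t5's `DiagramLifts` /
`DiagramUniversalFamilies`.  For a 1-morphism `Ψ : 𝒟 → 𝒟'` lying over `Φ` (`H : Ψ.OverHom O O' Φ`):

* `OverHom.lift_compat` — the homotopies through fully faithful structure functors (`OverData.lift`) commute with the
  `Ψ_{[γ]}`: `Ψ_a ◁ lift'(F γ₁, F γ₂) ≫ Ψ_{[γ₂]} = Ψ_{[γ₁]} ≫ lift(γ₁, γ₂) ▷ Ψ_w`;
* `OverHom.univFamily_η_compat` — hence so do the homotopies of the universal families `univFamily O W`,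
  `univFamily O' W'` (whiskered lifts) whenever `F(W) ⊆ W'`;
* `OverHom.compatibleWithRestrict` — for `F` the identity of the common oriented graph, `Ψ` is COMPATIBLE in the sense of
  Def. 3.5 (v) (`OneMorphism.CompatibleWith`) with the restrictions of the two universal families to any common
  saturated set of pairs (telecore families `𝒥`, contact structures `ℋ` — Def. 3.5 (iv)).

Consumer: the Def 3.5 (v) compatibility of the panalocalization morphism `D⊚ → D✠` with `𝔗_{An•}`, `ℋ_{An•}`
([AbsTopIII] Cor 5.5 (vi)).  Pure category theory; no claim of the paper is asserted; nothing here bears on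
[IUTchIII] Cor. 3.12.
-/

noncomputable section

namespace Literature.AnabelianGeometry.AbsoluteAnabelian

open _root_.CategoryTheory _root_.Quiver

universe v u w

namespace DiagramOfCategories

variable {V : Type w} [Quiver.{v} V] {V' : Type w} [Quiver.{v} V']
  {D : DiagramOfCategories.{v, u, w} V} {D' : DiagramOfCategories.{v, u, w} V'} {F : V ⥤q V'}

/-! ### Bookkeeping -/

/-- a functor respects heterogeneous equality of morphisms between equal objects. [folklore] -/
private theorem map_heq {A B : Type u} [Category.{v} A] [Category.{v} B] (G : A ⥤ B) {X Y X' Y' : A} (hX : X = X')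
    (hY : Y = Y') {f : X ⟶ Y} {f' : X' ⟶ Y'} (h : HEq f f') : HEq (G.map f) (G.map f') := by
  subst hX hY; cases h; rfl

/-- the computation behind `OverHom.lift_compat`, as abstract category algebra: two composites agreeing after an
invertible arrow. [folklore] -/
private theorem lift_compat_calc {C₀ : Type u} [Category.{v} C₀] {C₀' : Type u} [Category.{v} C₀'] (Φ : C₀ ⥤ C₀')
    {U₀ U₁ U₂ U₃ R : C₀'} {M₀ M₁ M₂ : C₀} {a : U₀ ⟶ U₁} {b : U₁ ⟶ U₂} {c : U₀ ⟶ U₃} {d : U₃ ⟶ U₂}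
    {Pp : U₀ ⟶ R} {Pq : U₁ ⟶ R} {Pqi : R ⟶ U₁} {T : R ⟶ Φ.obj M₀} {θq : U₂ ⟶ Φ.obj M₂} {θqi : Φ.obj M₂ ⟶ U₂}
    {θp : U₃ ⟶ Φ.obj M₁} {u : M₁ ⟶ M₀} {v : M₂ ⟶ M₀} {vi : M₀ ⟶ M₂} {l : M₁ ⟶ M₂}
    (f1 : a = Pp ≫ Pqi) (hq : Pqi ≫ Pq = 𝟙 R) (f2 : c ≫ θp ≫ Φ.map u = Pp ≫ T) (f3 : b ≫ θq ≫ Φ.map v = Pq ≫ T)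
    (f4 : d ≫ θq = θp ≫ Φ.map l) (f5 : l = u ≫ vi) (hv : vi ≫ v = 𝟙 M₀) (hv' : v ≫ vi = 𝟙 M₂)
    (hθq : θq ≫ θqi = 𝟙 U₂) : a ≫ b = c ≫ d := by
  have e1 : (a ≫ b) ≫ θq ≫ Φ.map v = Pp ≫ T := by
    rw [Category.assoc, f3, f1, Category.assoc, reassoc_of% hq]
  have e2 : (c ≫ d) ≫ θq ≫ Φ.map v = Pp ≫ T := by
    rw [Category.assoc, reassoc_of% f4, ← Φ.map_comp, f5, Category.assoc, hv, Category.comp_id, f2]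
  have split : (θq ≫ Φ.map v) ≫ Φ.map vi ≫ θqi = 𝟙 U₂ := by
    rw [Category.assoc, ← Φ.map_comp_assoc, hv', Φ.map_id, Category.id_comp, hθq]
  rw [← Category.comp_id (a ≫ b), ← split, ← Category.assoc, e1, ← e2, Category.assoc, split, Category.comp_id]

/-- the computation behind `OverHom.univFamily_η_compat`, as abstract category algebra. [folklore] -/
private theorem η_compat_calc {C₀ : Type u} [Category.{v} C₀] {C₀' : Type u} [Category.{v} C₀'] (G : C₀ ⥤ C₀')
    {M₀ M₁ M₂ M₃ : C₀} {Z₁ Z₂ : C₀'} {l' : M₀ ⟶ M₁} {q' : M₁ ⟶ M₂} {p' : M₀ ⟶ M₃} {k : M₃ ⟶ M₂}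
    {sq : G.obj M₂ ⟶ Z₂} {sp : G.obj M₃ ⟶ Z₁} {t : Z₁ ⟶ Z₂}
    (lc : l' ≫ q' = p' ≫ k) (nat : G.map k ≫ sq = sp ≫ t) :
    G.map l' ≫ G.map q' ≫ sq = (G.map p' ≫ sp) ≫ t := by
  rw [← G.map_comp_assoc, lc, G.map_comp_assoc, nat, Category.assoc]

/-- the homotopy of a decomposition, componentwise and heterogeneously: the lift whiskered by the suffix.
[cite: MochizukiAbsTopIII2015, Definition 3.5 (iv) p.76] -/
private theorem Decomp.η_app_heq' {V₀ : Type w} [Quiver.{v} V₀] {D₀ : DiagramOfCategories.{v, u, w} V₀}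
    {C₀ : Type u} [Category.{v} C₀] (O₀ : D₀.OverData C₀) (W₀ : V₀ → Prop) (hW₀ : ∀ w, W₀ w → (O₀.N w).FullyFaithful)
    {a b : V₀} {P Q : Path a b} (d : Decomp W₀ P Q) (x : D₀.obj a) :
    HEq ((d.η O₀ W₀ hW₀).app x) ((D₀.pathFunctor d.s).map ((O₀.lift (hW₀ d.w d.mem) d.p d.q).app x)) := by
  simp only [Decomp.η, NatTrans.comp_app, eqToHom_app, Functor.whiskerRight_app, eqToHom_comp_heq_iff]
  exact comp_eqToHom_heq _ _

namespace OneMorphism.OverHom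

variable {Ψ : OneMorphism F D D'} {C : Type u} [Category.{v} C] {C' : Type u} [Category.{v} C']
  {O : D.OverData C} {O' : D'.OverData C'} {Φ : C ⥤ C'} (H : Ψ.OverHom O O' Φ)

include H in
/-- **the homotopies through fully faithful structure functors commute with `Ψ`**: for `[γ₁], [γ₂] : a ⟶ w` with `N_w`,
`N'_{F w}` fully faithful, `Ψ_a ◁ lift'(F γ₁, F γ₂) ≫ Ψ_{[γ₂]} = Ψ_{[γ₁]} ≫ lift(γ₁, γ₂) ▷ Ψ_w` componentwise — the
compatibility square of Def. 3.5 (v) for the homotopies of Rmk. 3.5.1's "constant portion".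
[cite: MochizukiAbsTopIII2015, Definition 3.5 (v) p.76] -/
theorem lift_compat {a w : V} (hw : (O.N w).FullyFaithful) (hw' : (O'.N (F.obj w)).FullyFaithful)
    (p q : Path a w) (x : D.obj a) :
    (O'.lift hw' (F.mapPath p) (F.mapPath q)).app ((Ψ.app a).obj x) ≫ (Ψ.pathIso q).hom.app x =
      (Ψ.pathIso p).hom.app x ≫ (Ψ.app w).map ((O.lift hw p q).app x) := by
  apply hw'.map_injective
  refine ((O'.N (F.obj w)).map_comp _ _).trans (Eq.trans ?_ ((O'.N (F.obj w)).map_comp _ _).symm)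
  exact lift_compat_calc Φ (O'.map_lift_app hw' (F.mapPath p) (F.mapPath q) ((Ψ.app a).obj x))
    (Iso.inv_hom_id_app (O'.pathIso (F.mapPath q)) ((Ψ.app a).obj x)) (H.pathPrism p x) (H.pathPrism q x)
    ((H.θ w).hom.naturality ((O.lift hw p q).app x)) (O.map_lift_app hw p q x)
    (Iso.inv_hom_id_app (O.pathIso q) x) (Iso.hom_inv_id_app (O.pathIso q) x)
    (Iso.hom_inv_id_app (H.θ w) ((D.pathFunctor q).obj x))

/-! ### Compatibility with the universal families -/

variable (W : V → Prop) (hW : ∀ w, W w → (O.N w).FullyFaithful) (W' : V' → Prop)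
  (hW' : ∀ w, W' w → (O'.N w).FullyFaithful)

/-- `E_W(P, Q)` implies `E_{W'}(F P, F Q)` when `F(W) ⊆ W'`. [cite: MochizukiAbsTopIII2015, Definition 3.5 (iv) p.76] -/
theorem univE_map (hF : ∀ w, W w → W' (F.obj w)) {a b : V} {P Q : Path a b} (h : univE W P Q) :
    univE W' (F.mapPath P) (F.mapPath Q) := by
  obtain ⟨w, hw, p, q, s, hP, hQ⟩ := Classical.choice h
  subst hP hQ
  exact ⟨⟨F.obj w, hF w hw, F.mapPath p, F.mapPath q, F.mapPath s, Prefunctor.mapPath_comp F p s,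
    Prefunctor.mapPath_comp F q s⟩⟩

include H in
/-- **the homotopies of the universal families commute with `Ψ`**: for a pair `(P, Q) = ([σ]∘[γ₁], [σ]∘[γ₂])` of `E_W`
(and `F(W) ⊆ W'`), `Ψ_a ◁ ζ'_{(FP, FQ)} ≫ Ψ_{[Q]} = Ψ_{[P]} ≫ ζ_{(P,Q)} ▷ Ψ_b` componentwise (the `η_compat` square of
Def. 3.5 (v)). [cite: MochizukiAbsTopIII2015, Definition 3.5 (v) p.76] -/
theorem univFamily_η_compat (hF : ∀ w, W w → W' (F.obj w)) {a b : V} {P Q : Path a b} (h : univE W P Q)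
    (h' : univE W' (F.mapPath P) (F.mapPath Q)) (x : D.obj a) :
    ((univFamily O' W' hW').η h').app ((Ψ.app a).obj x) ≫ (Ψ.pathIso Q).hom.app x =
      (Ψ.pathIso P).hom.app x ≫ (Ψ.app b).map (((univFamily O W hW).η h).app x) := by
  obtain ⟨w, hw, p, q, s, hP, hQ⟩ := Classical.choice h
  subst hP hQ
  rw [univFamily_η_eq O' W' hW' h' ⟨F.obj w, hF w hw, F.mapPath p, F.mapPath q, F.mapPath s,
      Prefunctor.mapPath_comp F p s, Prefunctor.mapPath_comp F q s⟩,
    univFamily_η_eq O W hW h ⟨w, hw, p, q, s, rfl, rfl⟩]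
  refine heq_iff_eq.mp ?_
  have hη' : HEq (((⟨F.obj w, hF w hw, F.mapPath p, F.mapPath q, F.mapPath s, Prefunctor.mapPath_comp F p s,
        Prefunctor.mapPath_comp F q s⟩ : Decomp W' (F.mapPath (p.comp s)) (F.mapPath (q.comp s))).η O' W' hW').app
        ((Ψ.app a).obj x))
      ((D'.pathFunctor (F.mapPath s)).map ((O'.lift (hW' _ (hF w hw)) (F.mapPath p) (F.mapPath q)).app
        ((Ψ.app a).obj x))) :=
    Decomp.η_app_heq' O' W' hW' (⟨F.obj w, hF w hw, F.mapPath p, F.mapPath q, F.mapPath s, Prefunctor.mapPath_comp F p s,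
      Prefunctor.mapPath_comp F q s⟩ : Decomp W' (F.mapPath (p.comp s)) (F.mapPath (q.comp s))) ((Ψ.app a).obj x)
  have hL := heq_comp (by simp only [Functor.comp_obj, Prefunctor.mapPath_comp, pathFunctor_comp])
    (by simp only [Functor.comp_obj, Prefunctor.mapPath_comp, pathFunctor_comp])
    (by simp only [Functor.comp_obj, pathFunctor_comp]) hη' (Ψ.pathIso_comp_heq q s x)
  have hR := heq_comp (by simp only [Functor.comp_obj, Prefunctor.mapPath_comp, pathFunctor_comp])
    (by simp only [Functor.comp_obj, pathFunctor_comp]) (by simp only [Functor.comp_obj, pathFunctor_comp])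
    (Ψ.pathIso_comp_heq p s x)
    (map_heq (Ψ.app b) (by simp only [Functor.comp_obj, pathFunctor_comp])
      (by simp only [Functor.comp_obj, pathFunctor_comp])
      (Decomp.η_app_heq' O W hW (⟨w, hw, p, q, s, rfl, rfl⟩ : Decomp W (p.comp s) (q.comp s)) x))
  exact hL.trans ((heq_of_eq (η_compat_calc (D'.pathFunctor (F.mapPath s))
    (H.lift_compat (hW w hw) (hW' _ (hF w hw)) p q x) ((Ψ.pathIso s).hom.naturality ((O.lift (hW w hw) p q).app x)))).trans
    hR.symm)

end OneMorphism.OverHom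

/-! ### `F` the identity: Def 3.5 (v) compatibility with the restricted universal families -/

namespace OneMorphism.OverHom

variable {D₁ D₂ : DiagramOfCategories.{v, u, w} V} {Ψ : OneMorphism (𝟭q V) D₁ D₂}
  {C : Type u} [Category.{v} C] {C' : Type u} [Category.{v} C']
  {O₁ : D₁.OverData C} {O₂ : D₂.OverData C'} {Φ : C ⥤ C'} (H : Ψ.OverHom O₁ O₂ Φ)
  (W : V → Prop) (hW₁ : ∀ w, W w → (O₁.N w).FullyFaithful) (hW₂ : ∀ w, W w → (O₂.N w).FullyFaithful)

/-- **`Ψ` is compatible (Def. 3.5 (v)) with the two universal families restricted to any common saturated set of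
pairs** — for a 1-morphism over the identity of the common oriented graph lying over `Φ`: the boundary sets
correspond literally, and the homotopies commute with the `Ψ_{[γ]}` by `univFamily_η_compat`.  (Restrictions: telecore
families `𝒥`, contact structures `ℋ` generated by chosen pairs — Def. 3.5 (iv).)
[cite: MochizukiAbsTopIII2015, Definition 3.5 (v) p.76] -/
def compatibleWithRestrict (E : ∀ ⦃a b : V⦄, Path a b → Path a b → Prop) (hE : IsSaturated E)
    (hsub : ∀ ⦃a b : V⦄ ⦃p q : Path a b⦄, E p q → univE W p q) :
    Ψ.CompatibleWith ((univFamily O₁ W hW₁).restrictBoundary E hE hsub)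
      ((univFamily O₂ W hW₂).restrictBoundary E hE hsub) where
  pathIso p := Ψ.pathIso p
  pathIso_nil a := Ψ.pathIso_nil a
  pathIso_cons p e := Ψ.pathIso_cons p e
  boundary_iff p q := by
    change E p q ↔ E ((𝟭q V).mapPath p) ((𝟭q V).mapPath q)
    rw [Prefunctor.mapPath_id, Prefunctor.mapPath_id]
    exact Iff.rfl
  boundary_surj p' q' _ := ⟨p', q', Prefunctor.mapPath_id p', Prefunctor.mapPath_id q'⟩
  η_compat p q h := by
    ext x
    rw [NatTrans.comp_app, NatTrans.comp_app, Functor.whiskerLeft_app, Functor.whiskerRight_app]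
    exact H.univFamily_η_compat W hW₁ W hW₂ (fun _ hw => hw) (hsub h)
      (hsub (by rw [Prefunctor.mapPath_id, Prefunctor.mapPath_id]; exact h)) x

end OneMorphism.OverHom

end DiagramOfCategories

end Literature.AnabelianGeometry.AbsoluteAnabelian

end
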